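import Literature.NumberTheory.EllipticCurves.PAdicLFunctionTameDistributionProofs
import Literature.NumberTheory.EllipticCurves.PAdicLFunctionInterpolationHoldsProofs
import Literature.NumberTheory.EllipticCurves.PAdicMeasureTransform
import HarnessLib

/-!
# The tame-level Mazur–Swinnerton-Dyer measure: CONVERGENCE of the Riemann sums of `L_p(f, α, χ, T)`
# (Mazur–Tate–Teitelbaum §I.11–I.13 at tame level `m`) IN THE KERNEL — discharge of the named fact
# `tendsto_padicLRiemannSumTame` (PROOFS ONLY: no `def`, no named fact)

Companion of `Literature.NumberTheory.EllipticCurves.PAdicLFunctionTame` (p534793; cell bsd-2adic, seat conv-1, planner RULING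
RC-159 road P2) and of `PAdicLFunctionTameProofs` (Matsuno 2000 Lemma 2.2), `PAdicLFunctionTameDistributionProofs`
(MTT (10.2) at tame level). The tree's ABSTRACT `p`-adic Mellin-transform machinery
(`Literature.NumberTheory.EllipticCurves.PAdicMeasureTransform`: `tendsto_riemannSum_of_distribution` for any bounded set
function `μ : (n : ℕ) → ZMod (pⁿ) → ℚ_p` with the fibre relation) is instantiated with the `χ`-WEIGHTED tame measure
`a ↦ ∑_{b mod m} χ(b) μ_{f,α,m}((a + pⁿℤ_p) × {b})`: its Riemann sums ARE the tame Riemann sums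
(`padicLRiemannSumTame_eq_sum_weighted`), its fibre relation is `sum_filter_msdMeasureTame_succ` summed over `b`
(`sum_filter_weighted_msdMeasureTame_succ`), and its bound comes from the uniform Manin–Drinfeld denominator of the
`[r]⁺_f` (`exists_forall_ratPlusSymbol_eq_div_of_maninDrinfeld`, ALL `r ∈ ℚ`) and `‖χ(b)‖ ≤ 1`
(`exists_norm_weighted_msdMeasureTame_le`). **`tendsto_padicLRiemannSumTame_holds`**: after this file the three named
facts of `PAdicLFunctionTame` are all theorems.

References: B. Mazur, J. Tate, J. Teitelbaum, Invent. Math. 84 (1986), §I.10–I.13 (pp. 12–19) [MazurTateTeitelbaum1986Invent];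
B. Mazur, P. Swinnerton-Dyer, Invent. Math. 25 (1974), §8 [MazurSwinnertonDyer1974Invent]; L. Washington, GTM 83, §5.1, §7.2
[Washington1997].
-/

noncomputable section

open scoped MatrixGroups ModularForm

open CongruenceSubgroup Filter Topology Literature.NumberTheory.EllipticCurves.ModularForms

namespace Literature.NumberTheory.EllipticCurves

/-! ## The `χ`-weighted tame measure: fibre relation, bound, and `tendsto_padicLRiemannSumTame_holds` -/

section Tame

variable {N : ℕ} [NeZero N] (f : CuspForm (Gamma0 N) 2) {p : ℕ} [Fact p.Prime] {m : ℕ} [NeZero m]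

omit [NeZero N] in
/-- The tame Riemann sum is the Riemann sum of the `χ`-weighted distribution
`a ↦ ∑_{b mod m} χ(b) μ_{f,α,m}((a + pⁿℤ_p) × {b})` (re-bracketing). [cite: MazurTateTeitelbaum1986Invent, §I.13 (pp. 18–19)] -/
theorem padicLRiemannSumTame_eq_sum_weighted (α : ℚ_[p]) (χ : DirichletCharacter ℚ_[p] m) (k n : ℕ) :
    padicLRiemannSumTame f m α χ k n =
      ∑ᶠ ζ : rootsOfUnity (torsionOrder p) ℤ_[p], ∑ s : ZMod (p ^ n),
        (fun (n : ℕ) (a : ZMod (p ^ n)) ↦ ∑ b : ZMod m, χ b * msdMeasureTame f m α n a b)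
          (n + cyclotomicExponent p)
          (PadicInt.toZModPow (n + cyclotomicExponent p) ((ζ : ℤ_[p]ˣ) : ℤ_[p]) *
            (cyclotomicGenerator p : ZMod (p ^ (n + cyclotomicExponent p))) ^ s.val) *
          (s.val.choose k : ℚ_[p]) := by
  unfold padicLRiemannSumTame
  refine finsum_congr fun ζ ↦ Finset.sum_congr rfl fun s _ ↦ ?_
  rw [Finset.sum_mul]

/-- **Fibre relation of the `χ`-weighted tame measure** (sum of `sum_filter_msdMeasureTame_succ` over `b mod m`).
[cite: MazurTateTeitelbaum1986Invent, §I.10 Prop. (10.2) (p. 13)] -/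
theorem sum_filter_weighted_msdMeasureTame_succ (hf : IsNewform0 f)
    (hrat : ∀ r : ℚ, (ratPlusSymbol f r : ℝ) = normalizedPlusSymbol f r) (hpN : ¬ p ∣ N) (hmp : m.Coprime p)
    {ap : ℤ} (hap : cuspCoeff f p = ap) {α : ℚ_[p]} (hα₀ : α ≠ 0) (hα : α ^ 2 - ap * α + p = 0)
    (χ : DirichletCharacter ℚ_[p] m) (n : ℕ) (a : ZMod (p ^ n)) :
    ∑ a' ∈ Finset.univ.filter (fun a' : ZMod (p ^ (n + 1)) ↦
        ZMod.castHom (pow_dvd_pow p n.le_succ) (ZMod (p ^ n)) a' = a),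
        (∑ b : ZMod m, χ b * msdMeasureTame f m α (n + 1) a' b) =
      ∑ b : ZMod m, χ b * msdMeasureTame f m α n a b := by
  rw [Finset.sum_comm]
  refine Finset.sum_congr rfl fun b _ ↦ ?_
  rw [← Finset.mul_sum, sum_filter_msdMeasureTame_succ f hf hrat hpN hmp hap hα₀ hα n a b]

/-- A value of a `ℚ_p`-valued Dirichlet character has norm `≤ 1` (it is `0` or a root of unity). [folklore] -/
private theorem norm_dirichletCharacter_apply_le_one (χ : DirichletCharacter ℚ_[p] m) (b : ZMod m) : ‖χ b‖ ≤ 1 := by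
  by_cases hb : IsUnit b
  · obtain ⟨u, rfl⟩ := hb
    have hfin : IsOfFinOrder (χ.toUnitHom u) := MonoidHom.isOfFinOrder _ (isOfFinOrder_of_finite u)
    obtain ⟨k, hk, hpow⟩ := hfin.exists_pow_eq_one
    have hval : (χ (u : ZMod m)) ^ k = 1 := by
      have := congr_arg (fun x : ℚ_[p]ˣ ↦ (x : ℚ_[p])) hpow
      simpa [MulChar.coe_toUnitHom] using this
    have hn : ‖χ (u : ZMod m)‖ ^ k = 1 := by rw [← norm_pow, hval, norm_one]
    exact (pow_eq_one_iff_of_nonneg (norm_nonneg _) hk.ne').mp hn |>.le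
  · rw [χ.map_nonunit hb, norm_zero]
    exact zero_le_one

/-- **Boundedness of the `χ`-weighted tame measure** for `‖α‖ = 1`: the `[r]⁺_f` have ONE common denominator `D` for all
`r ∈ ℚ` (Manin–Drinfeld, `exists_forall_ratPlusSymbol_eq_div_of_maninDrinfeld`), so `‖μ_{f,α,m}(·)‖ ≤ 2‖1/D‖` and, the norm being
ultrametric and `‖χ(b)‖ ≤ 1`, the same bound holds for the weighted sum. [cite: MazurTateTeitelbaum1986Invent, §I.11 (pp. 13–14)] -/
theorem exists_norm_weighted_msdMeasureTame_le (hMD : exists_nsmul_modularSymbol_mem_periodLattice f) {α : ℚ_[p]}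
    (hαu : ‖α‖ = 1) (χ : DirichletCharacter ℚ_[p] m) :
    ∃ C : ℝ, ∀ (n : ℕ) (a : ZMod (p ^ n)), ‖∑ b : ZMod m, χ b * msdMeasureTame f m α n a b‖ ≤ C := by
  classical
  obtain ⟨D, hD, hden⟩ := exists_forall_ratPlusSymbol_eq_div_of_maninDrinfeld hMD
  set C : ℝ := ‖(D : ℚ_[p])‖⁻¹ with hC
  have hC0 : 0 ≤ C := inv_nonneg.mpr (norm_nonneg _)
  have hbd : ∀ r : ℚ, ‖(ratPlusSymbol f r : ℚ_[p])‖ ≤ C := fun r ↦ by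
    obtain ⟨z, hz⟩ := hden r
    rw [hz]
    push_cast
    rw [norm_div, div_eq_mul_inv]
    exact mul_le_of_le_one_left hC0 (Padic.norm_int_le_one z)
  have hαi : ‖α⁻¹‖ = 1 := by rw [norm_inv, hαu, inv_one]
  have hμ : ∀ (n : ℕ) (a : ZMod (p ^ n)) (b : ZMod m), ‖msdMeasureTame f m α n a b‖ ≤ 2 * C := by
    intro n a b
    rw [msdMeasureTame]
    calc _ ≤ ‖α⁻¹ ^ n * (ratPlusSymbol f (tameFraction p m n a b) : ℚ_[p])‖ +
          ‖α⁻¹ ^ (n + 1) * (ratPlusSymbol f ((p : ℚ) * tameFraction p m n a b) : ℚ_[p])‖ := norm_sub_le _ _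
      _ ≤ C + C := by
          refine add_le_add ?_ ?_ <;>
          · rw [norm_mul, norm_pow, hαi, one_pow, one_mul]
            exact hbd _
      _ = 2 * C := by ring
  refine ⟨2 * C, fun n a ↦ IsUltrametricDist.norm_sum_le_of_forall_le_of_nonneg (by positivity) fun b _ ↦ ?_⟩
  rw [norm_mul]
  calc ‖χ b‖ * ‖msdMeasureTame f m α n a b‖ ≤ 1 * (2 * C) :=
        mul_le_mul (norm_dirichletCharacter_apply_le_one χ b) (hμ n a b) (norm_nonneg _) zero_le_one
    _ = 2 * C := one_mul _

omit [NeZero N] in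
/-- **Discharge of `tendsto_padicLRiemannSumTame`** (Mazur–Tate–Teitelbaum §I.11–I.13 at tame level `m`): for a rational
normalised newform `f` of level `N` prime to `p`, `(m, p) = 1`, `a_p(f) = a_p`, `α` with `α² − a_p α + p = 0`, `‖α‖ = 1`, and every
`χ` mod `m` with values in `ℚ_p`, the Riemann sums of `L_p(f, α, χ, T)` converge to its coefficients.
[cite: MazurTateTeitelbaum1986Invent, §I.11–I.13 (pp. 13–19)] -/
theorem tendsto_padicLRiemannSumTame_holds : tendsto_padicLRiemannSumTame (N := N) (p := p) := by
  intro _ f hf hQ hpN m _ hmp ap hap α hα hαu χ k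
  have hα0 : α ≠ 0 := norm_ne_zero_iff.mp (by rw [hαu]; exact one_ne_zero)
  have hdist := sum_filter_weighted_msdMeasureTame_succ f hf (fun r ↦ ratCast_ratPlusSymbol_holds hf hQ r) hpN hmp
    hap hα0 hα χ
  have hbdd := exists_norm_weighted_msdMeasureTame_le f (exists_nsmul_modularSymbol_mem_periodLattice_of_isNewform0 hf hQ)
    hαu χ
  obtain ⟨C, hC⟩ := hbdd
  have h := tendsto_riemannSum_of_distribution
    (μ := fun (n : ℕ) (a : ZMod (p ^ n)) ↦ ∑ b : ZMod m, χ b * msdMeasureTame f m α n a b)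
    (RS := fun k n ↦ padicLRiemannSumTame f m α χ k n)
    (fun k n ↦ padicLRiemannSumTame_eq_sum_weighted f α χ k n) hdist hC k
  exact h

end Tame

end Literature.NumberTheory.EllipticCurves

end
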